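import Summits.BirchSwinnertonDyer.Rank1Residual.X12.O11.RamifiedEllipticUnitMechanism
import Literature.NumberTheory.EllipticCurves.BurungaleKobayashiNakamuraOta2026.LocalBottomIndex
import HarnessLib

/-!
# O11 (CM, analytic rank one, the RAMIFIED prime `p = |d_K| ≥ 5`): the RUBIN-FORMULA LINE for the
# value piece (R-PR)|IMC — three typed stubs `S_dict` (`m_loc = n + n'`), `S_B4` (`λ₀ = c + m_loc`),
# `S_open` (the analytic ramified Rubin formula `λ₀ = 2(n + n') + ord_p #Ш_an(W) + ord_p #Ш_an(W')`,
# OPEN) — and the PROVED composition `S_dict → S_B4 → S_open → RamifiedCMBottomClassIndexLawAt W p`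
# (cell `bsd-cm`, planner D112 (e)/(f); line designed by seat `bsd-cm-ram` g7 (sizing 2026-08-26T12:58Z);
# typed by seat `bsd-cm-k7r-c3` g5; NOTHING asserted)

HONEST FRAMING. `RamifiedEllipticUnitMechanism.lean` (seat k7r-c4) types the ATTACKED crux of the K7r
route as (R-PR)|IMC `RamifiedCMBottomClassIndexLawAt W p`: for every anticyclotomic elliptic-unit class
datum `D` (ram's `EllipticUnitClassData`, [BKNO] §3.3.1) with GLOBAL bottom index exponent `c`
(`D.HasBottomIndexExp c`: `p^c = [S_{p,rel}(E/K) : tors + 𝒪·z(𝟙)]`) satisfying the main-conjecture identity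
`n₀ + log_p #X[T] = c`, the value law `c = n + n' + ord_p #Ш_an(W) + ord_p #Ш_an(W')`. ram's cut (B)
("RUBIN-FORMULA") decomposes it through the LOCAL index exponents of
`Literature/…/BurungaleKobayashiNakamuraOta2026/LocalBottomIndex.lean` (seat k7r-c3 g5):
`λ₀(D)` (`D.HasLocalBottomIndexExp`: `p^{λ₀} = [E(K_𝔭) ⊗ ℤ_p : tors + 𝒪·loc_𝔭 z(𝟙)]`) and `m_loc`
(`HasBottomLocalMordellWeilIndexExp`: `p^{m_loc} = [E(K_𝔭) ⊗ ℤ_p : tors + loc_𝔭(E(K) ⊗ ℤ_p)]`):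

* `S_dict` = `RamifiedCMLocalMordellWeilDictAt W p` — INTRINSIC (no datum): at every analytic-rank-one
  O11 frame, `m_loc = n + n'` (the `p`-adic levels of the generators `P`, `P'` of `E(ℚ)`, `E'(ℚ)` in
  `E(ℚ_p)`, `E'(ℚ_p)`). Mechanism: the `±`-decomposition `E(K_𝔭) ⊗ ℤ_p = E(ℚ_p) ⊗ ℤ_p ⊕ E'(ℚ_p) ⊗ ℤ_p`
  under `Gal(K_𝔭/ℚ_p)` at the odd prime `p` and `E(K) ⊗ ℤ_p = ℤ_p P ⊕ ℤ_p P'` (ram 12:58Z: "π-free";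
  numerically 51/51 on the 𝒞₇ frames incl. the `v(u) = 1` rows `−1187/−1471`, k7r-c3 g4 RUNG-5929e1).
  PROVABLE-LOOKING with the tree's quadratic-descent / twist files; typed here as an input.
* `S_B4` = `RamifiedCMBottomLocalIndexSplitAt W p` — RELATIVE, SHARED `(D, c)`: at every such frame,
  for every datum `D` with `D.HasBottomIndexExp c` and the IMC identity, `m_loc = m ⟹ λ₀(D) = c + m`
  (index multiplicativity along `𝒪·z(𝟙) ⊆ E(K) ⊗ ℤ_p ⊆ S_p(E/K) = S_{p,rel}(E/K) ↪ E(K_𝔭) ⊗ ℤ_p`;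
  needs `T_pШ(E/K) = 0` and `Sel_str(K, E[p^∞])` finite — theorems in analytic rank one under GZK /
  the descent data — and the Kummer-at-`𝔭` property of `z(𝟙)` = seat ram's B1
  `BottomClass.bottom_mem_compactSelmerOver`). M-sized PROOF per ram; typed here as an input.
* `S_open` = `RamifiedCMRubinFormulaAt W p` — RELATIVE, SHARED `(D, c)`, under the IMC identity (junk-free
  for the same reason as the Value child: `scaleByP` shifts `λ₀` and `c` together and breaks the IMC
  hypothesis): `λ₀(D) = 2(n + n') + ord_p #Ш_an(W) + ord_p #Ш_an(W')` — by [BKNO] Thm. 7.2 at `χ = 𝟙` and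
  the unit bottom period (`ν₀ = 0`, `BETA-DESIGN-ram-g7.md` §7) this IS `ord_π ℒ_{p,v_ε}(φ)(𝟙) = 2(n+n') +
  ord_p #Ш_an(W) + ord_p #Ш_an(W')`, the ANALYTIC ramified Rubin formula (★_an)♯ in valuation form —
  [BKNO] §1.4's deferred statement. THE OPEN STUB; NOT in print. Stated in the `∀ λ₀`-form the
  composition needs (existence of `λ₀` comes from `S_B4` + `S_dict`).
* `ramifiedCMBottomClassIndexLawAt_of_dict_of_split_of_rubinFormula` — PROVED (linear arithmetic +
  uniqueness of `λ₀`): `S_dict → S_B4 → S_open → RamifiedCMBottomClassIndexLawAt W p`.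

Binders are VERBATIM those of `RamifiedCMBottomClassIndexLawAt` (frame, `r_an = 1`, anticyclotomic `κ`
with generator `γ`, frame data `P n P' n'`, `q = #Ш_an(W)`, `q' = #Ш_an(W')`, `ι φ Ω 𝓔 D c`, the IMC
identity). Nothing is asserted; no named fact is minted; (R-PR)|IMC, (R-EU), O11 and the K7r leaf stay
OPEN. These three `Prop`s are the registered stubs of the crux workfile `Lines/rubin-formula.lean` of the
K7r value child once the split (2″) files it (planner D112 (e)).
References: [BKNO] arXiv:2608.06879 (2026) §1.4, Thm. 1.8, §3.3.1, Def. 4.7, Thm. 7.2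
[BurungaleKobayashiNakamuraOta2026]; B. Perrin-Riou, Ann. Inst. Fourier 43 (1993) §3.3 (the conjecture);
K. Rubin, Invent. Math. 107 (1992) (the split-prime `p`-adic formula this line transposes); cell memos
`pub/bsd-cm/bsd-cm-ram/queue-g7/BETA-DESIGN-ram-g7.md` §4 cut (B), §7, §8 and STATUS 2026-08-26T12:58:18Z.
-/

noncomputable section

open scoped Classical

open WeierstrassCurve NumberField IsDedekindDomain Field PowerSeries
  Literature.NumberTheory.EllipticCurves
  Literature.NumberTheory.EllipticCurves.Rank1Residual
  Literature.NumberTheory.EllipticCurves.Rank1Residual.Typed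
  Literature.NumberTheory.EllipticCurves.Castella2018
  Literature.NumberTheory.EllipticCurves.BurungaleKobayashiNakamuraOta2026
  Literature.NumberTheory.GaloisRepresentations
  Summit.BirchSwinnertonDyer.Rank1Residual.Additive

namespace Summit.BirchSwinnertonDyer.Rank1Residual.X12.O11

variable (W : WeierstrassCurve ℚ) [W.IsElliptic] [W.IsGloballyMinimal] (p : ℕ) [Fact p.Prime]

section RubinFormulaLine

/-- **S_dict — the LOCAL MORDELL–WEIL DICTIONARY at the ramified prime (typed input; nothing asserted):
`m_loc = n + n'`.** At every analytic-rank-one O11 frame `(K, 𝔭, W', C)` of `(W, p)` and every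
anticyclotomic `ℤ_p`-tower `κ`, with the frame data (`P`, `P'` generators of `E(ℚ)`, `E'(ℚ)` modulo
torsion, `E(ℚ_p)[p] = 0 = E'(ℚ_p)[p]`, exact `p`-adic levels `n`, `n'`): the bottom local Mordell–Weil
index exponent is `n + n'`, i.e. `p^{n+n'} = [E(K_𝔭) ⊗ ℤ_p : tors + loc_𝔭(E(K) ⊗ ℤ_p)]`
(`HasBottomLocalMordellWeilIndexExp W p K 𝔭 κ (n + n')`). INTRINSIC (no elliptic-unit datum). Mechanism:
the `±`-decomposition of `E(K_𝔭) ⊗ ℤ_p` and of `E(K) ⊗ ℤ_p` under `Gal(K/ℚ)` at the odd prime `p`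
(cell derivation, seat ram 2026-08-26; 51/51 numerically on the 𝒞₇ frames). NOT a published statement;
a stub of the cell's Rubin-formula line. [cite: BurungaleKobayashiNakamuraOta2026, Thm. 1.8 and §1.4 (arXiv:2608.06879 pp. 7–8) (the objects; claim; preprint; shape only)]
[cite: SilvermanAEC2009, Exercise 10.16 (quadratic descent of the Mordell–Weil group)] -/
@[conjecture] def RamifiedCMLocalMordellWeilDictAt : Prop :=
  ∀ (K : Type) [Field K] [NumberField K] (𝔭 : HeightOneSpectrum (𝓞 K))
    (W' : WeierstrassCurve ℚ) [W'.IsElliptic] [W'.IsGloballyMinimal] (C : VariableChange ℚ),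
    IsFrame W p K 𝔭 W' C → W.analyticRank = 1 →
    ∀ (κ : ZpExtension K p), κ.IsAnticyclotomic →
      ∀ (P : W.toAffine.Point) (n : ℕ) (P' : W'.toAffine.Point) (n' : ℕ),
        ¬ IsOfFinAddOrder P →
        (∀ R : W.toAffine.Point, ∃ (k : ℤ) (T : W.toAffine.Point), IsOfFinAddOrder T ∧ R = k • P + T) →
        (∀ Q : (W.baseChange ℚ_[p]).toAffine.Point, p • Q = 0 → Q = 0) →
        (∃ Q : (W.baseChange ℚ_[p]).toAffine.Point, p ^ n • Q = W.toPadicPoint p P) →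
        (∀ Q : (W.baseChange ℚ_[p]).toAffine.Point, p ^ (n + 1) • Q ≠ W.toPadicPoint p P) →
        ¬ IsOfFinAddOrder P' →
        (∀ R : W'.toAffine.Point, ∃ (k : ℤ) (T : W'.toAffine.Point),
          IsOfFinAddOrder T ∧ R = k • P' + T) →
        (∀ Q : (W'.baseChange ℚ_[p]).toAffine.Point, p • Q = 0 → Q = 0) →
        (∃ Q : (W'.baseChange ℚ_[p]).toAffine.Point, p ^ n' • Q = W'.toPadicPoint p P') →
        (∀ Q : (W'.baseChange ℚ_[p]).toAffine.Point, p ^ (n' + 1) • Q ≠ W'.toPadicPoint p P') →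
        HasBottomLocalMordellWeilIndexExp W p K 𝔭 κ (n + n')

/-- **S_B4 — the BOTTOM INDEX SPLITS INTO GLOBAL × LOCAL (typed input, RELATIVE to the datum with the
SHARED exponent `c`; nothing asserted): `λ₀(D) = c + m_loc`.** At every analytic-rank-one O11 frame and
anticyclotomic tower with generator, for every anticyclotomic elliptic-unit class datum `D` with global
bottom index exponent `c` (`D.HasBottomIndexExp c`) satisfying the main-conjecture identity, and every
`m` with `HasBottomLocalMordellWeilIndexExp … m`: `D.HasLocalBottomIndexExp (c + m)`, i.e.
`[E(K_𝔭) ⊗ ℤ_p : tors + 𝒪·loc_𝔭 z(𝟙)] = [S_{p,rel}(E/K) : tors + 𝒪·z(𝟙)] · [E(K_𝔭) ⊗ ℤ_p : tors + loc_𝔭(E(K) ⊗ ℤ_p)]`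
— index multiplicativity along `𝒪·z(𝟙) ⊆ E(K) ⊗ ℤ_p ⊆ S_p(E/K) = S_{p,rel}(E/K) ↪ E(K_𝔭) ⊗ ℤ_p`, which
needs `T_pШ(E/K) = 0`, the finiteness of `Sel_str(K, E[p^∞])` (so that relaxed = full compact Selmer at
the bottom) — both theorems in analytic rank one under GZK / the descent data (K7r files) — and
`z(𝟙) ∈ S_p(E/K)` (Kummer at `𝔭`: seat ram's `BottomClass.bottom_mem_compactSelmerOver`, [BKNO] Lemma 7.1).
An M-sized PROOF by the cell's sizing; typed here as an input of the line.
[cite: BurungaleKobayashiNakamuraOta2026, Lemma 7.1, Thm. 7.2 and §1.4 (arXiv:2608.06879 pp. 8, 40–41) (claim; preprint; shape only)]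
[cite: PerrinRiou1987BSMF, §0 pp. 401–402 (the descent sequence `0 → E(L) ⊗ ℤ_p → S_p(L) → T_pШ → 0`)] -/
@[conjecture] def RamifiedCMBottomLocalIndexSplitAt : Prop :=
  ∀ (K : Type) [Field K] [NumberField K] (𝔭 : HeightOneSpectrum (𝓞 K))
    (W' : WeierstrassCurve ℚ) [W'.IsElliptic] [W'.IsGloballyMinimal] (C : VariableChange ℚ),
    IsFrame W p K 𝔭 W' C → W.analyticRank = 1 →
    ∀ (κ : ZpExtension K p), κ.IsAnticyclotomic →
      ∀ (γ : absoluteGaloisGroup K) [Fact (κ.IsTopGenerator γ)]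
        (ι : PadicAlgCl p ≃+* ℂ) (φ : HeckeCharacter K) (Ω : ℂ) (𝓔 : AcDualExpSystem W p K 𝔭 κ ι)
        (D : EllipticUnitClassData W p K 𝔭 κ γ ι φ Ω 𝓔) (c : ℕ), D.HasBottomIndexExp c →
        (∀ (n₀ : ℕ), AcSelmer.XAc.HasCharValuationAt (W.baseChange K) p κ 𝔭 ∅ γ n₀ →
          Finite {x : AcSelmer.XAc (W.baseChange K) p κ 𝔭 ∅ γ //
            (PowerSeries.X : IwasawaAlgebra p) • x = 0} →
          (n₀ : ℤ) + padicValNat p (Nat.card {x : AcSelmer.XAc (W.baseChange K) p κ 𝔭 ∅ γ //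
              (PowerSeries.X : IwasawaAlgebra p) • x = 0}) = c) →
        ∀ (m : ℕ), HasBottomLocalMordellWeilIndexExp W p K 𝔭 κ m → D.HasLocalBottomIndexExp (c + m)

/-- **S_open — THE ANALYTIC RAMIFIED RUBIN FORMULA in valuation form (typed input, RELATIVE, SHARED
`(D, c)`, under the IMC identity; THE OPEN STUB of the line; nothing asserted):
`λ₀(D) = 2(n + n') + ord_p #Ш_an(W) + ord_p #Ш_an(W')`.** At every analytic-rank-one O11 frame with its
data and every datum `D` with global exponent `c` satisfying the main-conjecture identity: every local
bottom index exponent `λ₀` of `D` (`D.HasLocalBottomIndexExp λ₀`) equals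
`2(n + n') + ord_p q + ord_p q'` (`q = #Ш_an(W)`, `q' = #Ш_an(W')`). READING: by [BKNO] Thm. 7.2 at the
trivial character, `ℒ_{p,v_ε}(φ)(𝟙) = exp*_ω(v_{−ε}(𝟙)) · log_ω(loc_𝔭 z(𝟙))`, and the bottom period
`exp*_ω(v_{−ε}(𝟙))` is a unit (cell derivation `ν₀ = 0`, `BETA-DESIGN-ram-g7.md` §7, refereed at
derivation tier), so `λ₀ = ord_π ℒ_{p,v_ε}(φ)(𝟙)` and the statement is the `p`-adic BSD-type formula for
[BKNO]'s INTEGRAL `ℒ` at `χ = 𝟙` with every ramified local factor explicit — the transposition to the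
RAMIFIED prime of Rubin's 1992 split-prime formula / of BDP–Kobayashi at inert primes; [BKNO] §1.4 defers
exactly this ("report elsewhere"). Junk data (`scaleByP`: `λ₀ ↦ λ₀ + 2`, `c ↦ c + 2`) fail the IMC
hypothesis, so the statement is not junk-refutable. CONSTRUCTION / OPEN; NOT in print.
[cite: BurungaleKobayashiNakamuraOta2026, Thm. 7.2, Def. 4.7 and §1.4 (arXiv:2608.06879 pp. 8, 27, 41) (claim; preprint; shape only)]
[cite: GrossZagier1986, Thm. I.(7.3) (rationality of #Ш_an)] -/
@[conjecture] def RamifiedCMRubinFormulaAt : Prop :=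
  ∀ (K : Type) [Field K] [NumberField K] (𝔭 : HeightOneSpectrum (𝓞 K))
    (W' : WeierstrassCurve ℚ) [W'.IsElliptic] [W'.IsGloballyMinimal] (C : VariableChange ℚ),
    IsFrame W p K 𝔭 W' C → W.analyticRank = 1 →
    ∀ (κ : ZpExtension K p), κ.IsAnticyclotomic →
      ∀ (γ : absoluteGaloisGroup K) [Fact (κ.IsTopGenerator γ)]
        (P : W.toAffine.Point) (n : ℕ) (P' : W'.toAffine.Point) (n' : ℕ),
        ¬ IsOfFinAddOrder P →
        (∀ R : W.toAffine.Point, ∃ (k : ℤ) (T : W.toAffine.Point), IsOfFinAddOrder T ∧ R = k • P + T) →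
        (∀ Q : (W.baseChange ℚ_[p]).toAffine.Point, p • Q = 0 → Q = 0) →
        (∃ Q : (W.baseChange ℚ_[p]).toAffine.Point, p ^ n • Q = W.toPadicPoint p P) →
        (∀ Q : (W.baseChange ℚ_[p]).toAffine.Point, p ^ (n + 1) • Q ≠ W.toPadicPoint p P) →
        ¬ IsOfFinAddOrder P' →
        (∀ R : W'.toAffine.Point, ∃ (k : ℤ) (T : W'.toAffine.Point),
          IsOfFinAddOrder T ∧ R = k • P' + T) →
        (∀ Q : (W'.baseChange ℚ_[p]).toAffine.Point, p • Q = 0 → Q = 0) →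
        (∃ Q : (W'.baseChange ℚ_[p]).toAffine.Point, p ^ n' • Q = W'.toPadicPoint p P') →
        (∀ Q : (W'.baseChange ℚ_[p]).toAffine.Point, p ^ (n' + 1) • Q ≠ W'.toPadicPoint p P') →
        ∀ (q q' : ℚ), shaAn W = (q : ℂ) → shaAn W' = (q' : ℂ) →
        ∀ (ι : PadicAlgCl p ≃+* ℂ) (φ : HeckeCharacter K) (Ω : ℂ) (𝓔 : AcDualExpSystem W p K 𝔭 κ ι)
          (D : EllipticUnitClassData W p K 𝔭 κ γ ι φ Ω 𝓔) (c : ℕ), D.HasBottomIndexExp c →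
          (∀ (n₀ : ℕ), AcSelmer.XAc.HasCharValuationAt (W.baseChange K) p κ 𝔭 ∅ γ n₀ →
            Finite {x : AcSelmer.XAc (W.baseChange K) p κ 𝔭 ∅ γ //
              (PowerSeries.X : IwasawaAlgebra p) • x = 0} →
            (n₀ : ℤ) + padicValNat p (Nat.card {x : AcSelmer.XAc (W.baseChange K) p κ 𝔭 ∅ γ //
                (PowerSeries.X : IwasawaAlgebra p) • x = 0}) = c) →
          ∀ (l : ℕ), D.HasLocalBottomIndexExp l →
            (l : ℤ) = 2 * ((n : ℤ) + n') + padicValRat p q + padicValRat p q'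

variable {W p}

omit [W.IsGloballyMinimal] in
/-- **THE COMPOSITION OF THE LINE (PROVED): `S_dict → S_B4 → S_open → (R-PR)|IMC`.** Given the datum `D`
with global exponent `c` and its IMC identity at an analytic-rank-one frame: `S_dict` gives
`m_loc = n + n'`, `S_B4` gives `λ₀(D) = c + (n + n')`, `S_open` gives
`λ₀(D) = 2(n + n') + ord_p q + ord_p q'`; hence `c = n + n' + ord_p q + ord_p q'`, the value law
`RamifiedCMBottomClassIndexLawAt W p`. Linear arithmetic; the skeleton `Value_of` of the crux workfile
`Lines/rubin-formula.lean` (planner D112 (e)). [cite: Miller2011LMS, Def. 1.1] -/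
theorem ramifiedCMBottomClassIndexLawAt_of_dict_of_split_of_rubinFormula
    (hdict : RamifiedCMLocalMordellWeilDictAt W p) (hsplit : RamifiedCMBottomLocalIndexSplitAt W p)
    (hopen : RamifiedCMRubinFormulaAt W p) : RamifiedCMBottomClassIndexLawAt W p := by
  intro K _ _ 𝔭 W' _ _ C hF hr κ hκ γ _ P n P' n' hP hgen htors hdiv hndiv hP' hgen' htors' hdiv' hndiv'
    q q' hq hq' ι φ Ω 𝓔 D c hc himc
  have hm : HasBottomLocalMordellWeilIndexExp W p K 𝔭 κ (n + n') :=
    hdict K 𝔭 W' C hF hr κ hκ P n P' n' hP hgen htors hdiv hndiv hP' hgen' htors' hdiv' hndiv'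
  have hl : D.HasLocalBottomIndexExp (c + (n + n')) :=
    hsplit K 𝔭 W' C hF hr κ hκ γ ι φ Ω 𝓔 D c hc himc (n + n') hm
  have hval := hopen K 𝔭 W' C hF hr κ hκ γ P n P' n' hP hgen htors hdiv hndiv hP' hgen' htors' hdiv'
    hndiv' q q' hq hq' ι φ Ω 𝓔 D c hc himc (c + (n + n')) hl
  push_cast at hval
  linarith

end RubinFormulaLine

end Summit.BirchSwinnertonDyer.Rank1Residual.X12.O11

end
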